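import Literature.NumberTheory.EllipticCurves.ComplexMultiplicationBurungaleFlachDescentProofs
import Literature.NumberTheory.EllipticCurves.IsogenyDualProofs
import HarnessLib

/-!
# bsd.S28 (geometric-CM form): the isogeny step through Cassels' quotient invariance

Sibling proof file of `Literature.NumberTheory.EllipticCurves.ComplexMultiplication` for the named
fact `Literature.NumberTheory.EllipticCurves.bsdTriple_of_hasCM_of_L_one_ne_zero` (**bsd.S28**,
full Birch–Swinnerton-Dyer statement `W.BSDTriple` for a globally minimal `W/ℚ` with (geometric)
complex multiplication and `L(E,1) ≠ 0`; Burungale–Flach, *Camb. J. Math.* 12 (2024), Thm. 1.1 /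
Cor. 2 and the sentence following Cor. 2, arXiv:2206.09874 p. 4: *"Any CM elliptic curve `E/ℚ`
with `L(E/ℚ,1) ≠ 0` satisfies the assumptions of Corollary 2"*, "CM" meaning CM by `𝓞_K` in the
paper's standing convention, §1, first sentence).

The first sibling `ComplexMultiplicationBSDTripleProofs.lean` reduced the fact to four printed
leaves: Burungale–Flach Cor. 2 over `ℚ` (through
`Literature.NumberTheory.EllipticCurves.bsdTriple_of_j_mem_maximalCMJInvariants_of_L_one_ne_zero`), the
isogeny to a curve with CM by the maximal order
(`Literature.NumberTheory.EllipticCurves.exists_isIsogenous_j_mem_maximalCMJInvariants_of_hasCM`,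
Silverman *Advanced Topics* Ex. 2.12(b)), Knapp's Thm. 11.67
(`Literature.NumberTheory.EllipticCurves.LFunction_eq_of_isIsogenous`) and the *truth form* of
the isogeny invariance of BSD, `WeierstrassCurve.bsdTriple_iff_of_isIsogenous` (Milne, *ADT*,
Thm. I.7.3). Meanwhile the decomposition of the Burungale–Flach leaf itself
(`ComplexMultiplicationBurungaleFlachDescent*.lean`, `BSDQuadraticDescent.lean`) vendored the
*quotient form* of Cassels' theorem, `WeierstrassCurve.bsdRHS_eq_of_isIsogenous` (if `W ∼ W'`
over `ℚ` and `Ш(W)` is finite then `Ш(W')` is finite and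
`#Ш · Reg · Ω · ∏ c_p / #E(ℚ)_tors²` agrees on `W` and `W'`; Cassels, J. reine angew. Math. 217
(1965); Milne, *ADT*, I.7.3 with Remark I.7.4; Dokchitser–Dokchitser, Ann. of Math. 172 (2010),
proof of Thm. 8), which the proof of Cor. 2 needs anyway ("By isogeny invariance of BSD …").
This file shows, sorry-free, that the quotient form suffices for the isogeny step of bsd.S28 as
well, so that the truth form drops out of the trust base:

* `WeierstrassCurve.bsdTriple_of_isIsogenous_of_finite_point` — **BSD descends along a
  `ℚ`-isogeny `W ∼ W'` when `E'(ℚ)` is finite**, from Knapp 11.67 (`L(W,s) = L(W',s)`, so equal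
  analytic ranks and leading coefficients: the first sibling's
  `Literature.NumberTheory.EllipticCurves.analyticRank_eq_of_isIsogenous`,
  `Literature.NumberTheory.EllipticCurves.leadingLCoeff_eq_of_isIsogenous`) and Cassels' quotient
  invariance applied to the **dual isogeny** `W' ∼ W`, which the tree *proves*
  (`WeierstrassCurve.IsIsogenous.symm_of_charZero`, `IsogenyDualProofs.lean`, Silverman *AEC*
  III.6.1(a)); the Mordell–Weil side of RANK is `0 = 0` because finiteness of the group of
  rational points descends along isogenies (the parent's proved
  `Literature.NumberTheory.EllipticCurves.finite_point_of_isIsogenous`);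
* `WeierstrassCurve.bsdTriple_of_isIsogenous_of_facts` and
  `WeierstrassCurve.bsdTriple_iff_of_isIsogenous_of_facts` — in arbitrary rank the same argument,
  with the Mordell–Weil rank transported by the prelude fact
  `WeierstrassCurve.mordellWeilRank_eq_of_isIsogenous` (Silverman *AEC* III.6.2 with VIII), gives
  **Milne's Thm. I.7.3 in the tree's truth form from Knapp 11.67, the isogeny invariance of the
  rank and Cassels' quotient invariance** — a proved reduction of the first sibling's leaf
  `bsdTriple_iff_of_isIsogenous` to named facts that the Burungale–Flach chain already uses;
* `Literature.NumberTheory.EllipticCurves.bsdTriple_of_hasCM_of_L_one_ne_zero_of_BurungaleFlach2024`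
  — **bsd.S28 (geometric-CM form) from Burungale–Flach's Corollary 2 over `ℚ` as printed**
  (`Literature.NumberTheory.EllipticCurves.BurungaleFlach2024_bsd_rat`, which records the
  finiteness of `E(ℚ)` the corollary prints), Silverman's Ex. 2.12(b), Knapp 11.67 and Cassels'
  quotient invariance; and its compositions with the level-2 and level-3 assemblies of the
  Burungale–Flach chain (`…_of_level2`, `…_of_level3`), whose hypotheses are then exactly those
  of `Literature.NumberTheory.EllipticCurves.bsdTriple_of_j_mem_maximalCMJInvariants_of_L_one_ne_zero_of_level2`
  (resp. `…_of_level3`) plus Silverman's Ex. 2.12(b) — at level 3 with no further leaf at all;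
* the converse bookkeeping
  `Literature.NumberTheory.EllipticCurves.bsdTriple_of_j_mem_maximalCMJInvariants_of_L_one_ne_zero_of_hasCM`:
  the geometric-CM form gives back the verbatim (maximal-order) form under the parent's fact
  `Literature.NumberTheory.EllipticCurves.hasCM_of_j_mem_maximalCMJInvariants` (Silverman *AEC*
  C.11.3.1), so the two forms of bsd.S28 are equivalent modulo 1994-vintage CM theory.

So, after this file, the trust base of `bsdTriple_of_hasCM_of_L_one_ne_zero` is that of the
verbatim form `bsdTriple_of_j_mem_maximalCMJInvariants_of_L_one_ne_zero` (whatever level of the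
Burungale–Flach chain one stops at — each level already lists `LFunction_eq_of_isIsogenous` and
`bsdRHS_eq_of_isIsogenous` among its leaves from level 3 on) plus the single fact
`exists_isIsogenous_j_mem_maximalCMJInvariants_of_hasCM`, itself reduced in
`ComplexMultiplicationMaximalOrderProofs.lean` to the CM `j`-invariant classification
(`WeierstrassCurve.hasCM_iff_j_mem`, the explicit `2`-, `2`-, `3`-, `2`-isogenies for
`D = -12, -16, -27, -28` being proved there). The discharge
`bsdTriple_of_hasCM_of_L_one_ne_zero_holds` is *not* asserted: it is
`bsdTriple_of_hasCM_of_L_one_ne_zero_of_BurungaleFlach2024 hBF hB hKn hISO` for proofs of those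
four facts, none of which Mathlib (v4.32.0: no CM theory, no Hecke characters, no Iwasawa theory,
no Cassels–Tate pairing, no Néron models) can presently supply.

## Architecture of the printed argument (Burungale–Flach 2024, p. 4; Milne *ADT* I.7)

Let `W/ℚ` be globally minimal with `End_{ℚ̄}(E) ≠ ℤ` and `L(E,1) ≠ 0`. (B) `E ∼ E'` over `ℚ` with
`End_{ℚ̄}(E') = 𝓞_K`, `E'` in a globally minimal model `W'` (Silverman *AT* Ex. 2.12(b); *AEC*
VIII.8.3). (C) `L(E',s) = L(E,s)` (Knapp 11.67), so `L(E',1) ≠ 0` and `r_an(E) = r_an(E') = 0`.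
(A) Cor. 2 for `E'`: `E'(ℚ)`, `Ш(E')` finite, `L(E',1) = #Ш(E') Ω(E') ∏ c_p(E') / #E'(ℚ)²`.
(I) Cassels: along the dual isogeny `E' → E` (Silverman III.6.1), `Ш(E)` is finite and the BSD
quotients of `W` and `W'` agree; `E(ℚ)` is finite with `E'(ℚ)` (finite kernel); hence RANK
(`0 = 0`), SHAFIN and LEAD for `W`. This is the elliptic-curve case of Milne's proof of I.7.3
(p. 97: Lemma I.7.1 — (a) `L_S(s,A) = L_S(s,B)`, (b) `Ш(A)` finite iff `Ш(B)` finite —, "`r` the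
common rank of the groups of `K`-rational points", and the comparison of the remaining terms,
formula (7.3.1), p. 98; for elliptic curves the theorem is Cassels 1965, Notes p. 101).

## Design notes

* Pure theorems, no new `def`: the file is kernel-reviewed under the append protocol; nothing of
  the tree is restated (the quotient fact comes from `BSDQuadraticDescent.lean` and the level-2/3
  Burungale–Flach assemblies from `ComplexMultiplicationBurungaleFlachDescent(Proofs).lean`, all
  through the single import `ComplexMultiplicationBurungaleFlachDescentProofs`; the dual isogeny
  from `IsogenyDualProofs.lean`).
* `bsdTriple_of_isIsogenous_of_finite_point` avoids `mordellWeilRank_eq_of_isIsogenous`: in rank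
  zero both Mordell–Weil ranks vanish by finiteness (`mordellWeilRank_eq_zero_of_finite`), which is
  why the bsd.S28 assembly needs one fact fewer than the general truth form.
* Group rules of the topic: `noncomputable section`, `open scoped Classical`; curve-level
  statements are deliberate dot-notation extensions in `namespace WeierstrassCurve`, the bsd.S28
  assemblies live in `namespace Literature.NumberTheory.EllipticCurves` next to the fact.

## References

* A. Burungale, M. Flach, *The conjecture of Birch and Swinnerton-Dyer for certain elliptic curves
  with complex multiplication*, Camb. J. Math. 12 (2024), Thm. 1.1, Cor. 2 and its proof, and the
  sentence following it (arXiv:2206.09874, pp. 3–4). [BurungaleFlach2024]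
* J. W. S. Cassels, *Arithmetic on curves of genus 1. VIII: On conjectures of Birch and
  Swinnerton-Dyer*, J. reine angew. Math. 217 (1965), 180–199. [Cassels1965ArithmeticVIII]
* J. S. Milne, *Arithmetic Duality Theorems*, 2nd ed. (2006), I.7: Lemma 7.1 (p. 96), Thm. 7.3
  (p. 97), (7.3.1) (p. 98), Remark 7.4 (p. 100), Notes (p. 101: "For elliptic curves, Theorem 7.3
  was proved by Cassels (1965)"). [MilneADT2006]
* A. W. Knapp, *Elliptic Curves*, Princeton (1992), Thm. 11.67. [Knapp1993]
* J. H. Silverman, *The Arithmetic of Elliptic Curves*, 2nd ed. (2009), III.6.1–6.2, VIII.8.3,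
  App. C.11.3.1. [SilvermanAEC2009]
* J. H. Silverman, *Advanced Topics in the Arithmetic of Elliptic Curves* (1994), II, Ex. 2.12(b);
  App. A §3. [SilvermanAdvancedTopics1994]
-/

noncomputable section

open scoped Classical

namespace WeierstrassCurve

open Literature.NumberTheory.EllipticCurves

/-! ### BSD descends along a `ℚ`-isogeny (Cassels' quotient form + Knapp 11.67) -/

/-- **BSD descends along a `ℚ`-isogeny in rank zero.** Let `W ∼ W'` be `ℚ`-isogenous globally
minimal elliptic curves with `E'(ℚ)` finite. If `W'.BSDTriple` holds then so does `W.BSDTriple`: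
`L(W,s) = L(W',s)` (Knapp, Thm. 11.67, hypothesis `hKn`) gives `r_an(W) = r_an(W') = rank E'(ℚ) = 0`
and equal leading coefficients; `E(ℚ)` is finite with `E'(ℚ)`
(`finite_point_of_isIsogenous`), so `rank E(ℚ) = 0`; and Cassels' isogeny invariance of the BSD
quotient (hypothesis `hISO`, Milne *ADT* I.7.3 / Remark I.7.4) applied to the dual isogeny
`W' ∼ W` (`IsIsogenous.symm_of_charZero`, Silverman *AEC* III.6.1) transports the finiteness of
`Ш` and the right-hand side. [cite: MilneADT2006, Thm. I.7.3 (p. 97) with Lemma I.7.1 (p. 96)]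
[cite: Cassels1965ArithmeticVIII] [cite: Knapp1993, Thm. 11.67] -/
theorem bsdTriple_of_isIsogenous_of_finite_point
    (hKn : LFunction_eq_of_isIsogenous) (hISO : bsdRHS_eq_of_isIsogenous)
    {W W' : WeierstrassCurve ℚ} [W.IsElliptic] [W'.IsElliptic] [W.IsGloballyMinimal]
    [W'.IsGloballyMinimal] (hiso : IsIsogenous W W') (hfin' : Finite W'.toAffine.Point)
    (h' : W'.BSDTriple) : W.BSDTriple := by
  obtain ⟨hrank', hsha', hlead'⟩ := h'
  obtain ⟨hsha, hrhs⟩ := hISO W' W hiso.symm_of_charZero hsha'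
  have hfin : Finite W.toAffine.Point := finite_point_of_isIsogenous hiso hfin'
  refine ⟨?_, hsha, ?_⟩
  · show W.analyticRank = W.mordellWeilRank
    have hrank'' : W'.analyticRank = W'.mordellWeilRank := hrank'
    rw [analyticRank_eq_of_isIsogenous hKn hiso, hrank'', mordellWeilRank_eq_zero_of_finite W' hfin',
      mordellWeilRank_eq_zero_of_finite W hfin]
  · show W.leadingLCoeff = (W.bsdRHS : ℂ)
    have hlead'' : W'.leadingLCoeff = (W'.bsdRHS : ℂ) := hlead'
    rw [leadingLCoeff_eq_of_isIsogenous hKn hiso, hlead'', hrhs]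

/-- **BSD descends along a `ℚ`-isogeny** (arbitrary rank). Let `W ∼ W'` be `ℚ`-isogenous globally
minimal elliptic curves. If `W'.BSDTriple` holds then so does `W.BSDTriple`, from: Knapp 11.67
(`hKn`: equal `L`-series, hence equal analytic ranks and leading coefficients — Milne *ADT*
Lemma I.7.1(a)), the isogeny invariance of the Mordell–Weil rank (`hMW`, the prelude fact
`mordellWeilRank_eq_of_isIsogenous`, Silverman *AEC* III.6.2 with VIII; "`r` the common rank" in
Milne's proof) and Cassels' isogeny invariance of the BSD quotient (`hISO`) along the dual
isogeny `W' ∼ W` (`IsIsogenous.symm_of_charZero`).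
[cite: MilneADT2006, Thm. I.7.3 (p. 97) with Lemma I.7.1 (p. 96)]
[cite: Cassels1965ArithmeticVIII] [cite: Knapp1993, Thm. 11.67] -/
theorem bsdTriple_of_isIsogenous_of_facts
    (hKn : LFunction_eq_of_isIsogenous) (hMW : mordellWeilRank_eq_of_isIsogenous (K := ℚ))
    (hISO : bsdRHS_eq_of_isIsogenous)
    {W W' : WeierstrassCurve ℚ} [W.IsElliptic] [W'.IsElliptic] [W.IsGloballyMinimal]
    [W'.IsGloballyMinimal] (hiso : IsIsogenous W W') (h' : W'.BSDTriple) : W.BSDTriple := by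
  obtain ⟨hrank', hsha', hlead'⟩ := h'
  obtain ⟨hsha, hrhs⟩ := hISO W' W hiso.symm_of_charZero hsha'
  refine ⟨?_, hsha, ?_⟩
  · show W.analyticRank = W.mordellWeilRank
    have hrank'' : W'.analyticRank = W'.mordellWeilRank := hrank'
    rw [analyticRank_eq_of_isIsogenous hKn hiso, hrank'', hMW hiso]
  · show W.leadingLCoeff = (W.bsdRHS : ℂ)
    have hlead'' : W'.leadingLCoeff = (W'.bsdRHS : ℂ) := hlead'
    rw [leadingLCoeff_eq_of_isIsogenous hKn hiso, hlead'', hrhs]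

/-- **Milne's Theorem I.7.3 (truth form) from Knapp 11.67, the isogeny invariance of the rank and
Cassels' quotient invariance.** The named fact `bsdTriple_iff_of_isIsogenous` of
`ComplexMultiplicationBSDTripleProofs.lean` ("if `W ∼ W'` over `ℚ`, both globally minimal, then
BSD holds for `W` iff it holds for `W'`"; Milne, *ADT*, Thm. I.7.3, for elliptic curves Cassels
1965) follows from `LFunction_eq_of_isIsogenous` (`hKn`), `mordellWeilRank_eq_of_isIsogenous`
(`hMW`) and `bsdRHS_eq_of_isIsogenous` (`hISO`) by `bsdTriple_of_isIsogenous_of_facts` in both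
directions, isogeny being symmetric for elliptic curves in characteristic `0`
(`IsIsogenous.symm_of_charZero`, proved). This is the structure of Milne's proof (Lemma I.7.1,
the common rank, and the comparison (7.3.1) of the remaining terms); for elliptic curves the
theorem is due to Cassels (Milne, Notes to I.7, p. 101).
[cite: MilneADT2006, Thm. I.7.3 (p. 97) with Lemma I.7.1 (p. 96) and (7.3.1) (p. 98)]
[cite: Cassels1965ArithmeticVIII] -/
theorem bsdTriple_iff_of_isIsogenous_of_facts
    (hKn : LFunction_eq_of_isIsogenous) (hMW : mordellWeilRank_eq_of_isIsogenous (K := ℚ))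
    (hISO : bsdRHS_eq_of_isIsogenous) : bsdTriple_iff_of_isIsogenous :=
  fun _W _W' _ _ _ _ hiso =>
    ⟨fun h => bsdTriple_of_isIsogenous_of_facts hKn hMW hISO hiso.symm_of_charZero h,
      fun h' => bsdTriple_of_isIsogenous_of_facts hKn hMW hISO hiso h'⟩

end WeierstrassCurve

namespace Literature.NumberTheory.EllipticCurves

open WeierstrassCurve

/-! ### bsd.S28 (geometric-CM form) from Corollary 2 as printed and Cassels' quotient form -/

/-- **bsd.S28 (Burungale–Flach, geometric-CM form) from Corollary 2 over `ℚ` as printed.** The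
named fact `bsdTriple_of_hasCM_of_L_one_ne_zero` follows from:
`hBF` — Burungale–Flach, Cor. 2 at `F⁺ = ℚ` with the sentence following it, as printed
(`BurungaleFlach2024_bsd_rat`: `E(ℚ)`, `Ш(E/ℚ)` finite and
`L(E,1)/Ω(E) = #Ш · ∏ c_p / #E(ℚ)²` for `j(E) ∈ maximalCMJInvariants`, `L(E,1) ≠ 0`);
`hB` — Silverman *AT* Ex. 2.12(b) + App. A §3 (`exists_isIsogenous_j_mem_maximalCMJInvariants_of_hasCM`);
`hKn` — Knapp Thm. 11.67 (`LFunction_eq_of_isIsogenous`);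
`hISO` — Cassels' isogeny invariance of the BSD quotient (`WeierstrassCurve.bsdRHS_eq_of_isIsogenous`).
Proof ((B)–(C)–(A)–(I) of the module docstring): take `W'` globally minimal, `W ∼ W'`,
`j(W') ∈ maximalCMJInvariants` (`exists_isGloballyMinimal_isIsogenous_of_hasCM`); then
`L(W',1) = L(W,1) ≠ 0`, Cor. 2 gives `E'(ℚ)` finite and (level-1 assembly
`bsdTriple_of_j_mem_maximalCMJInvariants_of_L_one_ne_zero_of_BurungaleFlach2024`) `W'.BSDTriple`,
which descends to `W` by `WeierstrassCurve.bsdTriple_of_isIsogenous_of_finite_point`. Compared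
with `bsdTriple_of_hasCM_of_L_one_ne_zero_of_facts` the truth-form leaf
`bsdTriple_iff_of_isIsogenous` is replaced by the quotient form already used under the
Burungale–Flach leaf. [cite: BurungaleFlach2024, Cor. 2 and the sentence following its proof (arXiv p. 4)]
[cite: Cassels1965ArithmeticVIII] -/
theorem bsdTriple_of_hasCM_of_L_one_ne_zero_of_BurungaleFlach2024
    (hBF : BurungaleFlach2024_bsd_rat)
    (hB : exists_isIsogenous_j_mem_maximalCMJInvariants_of_hasCM)
    (hKn : LFunction_eq_of_isIsogenous) (hISO : bsdRHS_eq_of_isIsogenous) :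
    bsdTriple_of_hasCM_of_L_one_ne_zero := by
  intro W _ _ hCM hL
  obtain ⟨W', hE', hmin', hiso, hj'⟩ := exists_isGloballyMinimal_isIsogenous_of_hasCM hB W hCM
  have hL' : W'.entireLFunction 1 ≠ 0 := by
    rwa [← entireLFunction_eq_of_isIsogenous hKn hiso]
  obtain ⟨hfin', -, -⟩ := hBF W' hj' hL'
  exact bsdTriple_of_isIsogenous_of_finite_point hKn hISO hiso hfin'
    (bsdTriple_of_j_mem_maximalCMJInvariants_of_L_one_ne_zero_of_BurungaleFlach2024 hBF W' hj' hL')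

/-- **bsd.S28 (geometric-CM form) from its verbatim form plus the finiteness of `E(ℚ)`.** Variant
of `bsdTriple_of_hasCM_of_L_one_ne_zero_of_BurungaleFlach2024` taking the tree's verbatim bsd.S28
(`bsdTriple_of_j_mem_maximalCMJInvariants_of_L_one_ne_zero`, `hA`) together with the Coates–Wiles
finiteness `finite_point_of_j_mem_maximalCMJInvariants_of_L_one_ne_zero` (`hCW`, Coates–Wiles
1977 Thm. 1 read against Mordell–Weil) in place of Corollary 2 as printed (the two are
equivalent, `BurungaleFlach2024_bsd_rat_of_bsdTriple`).
[cite: BurungaleFlach2024, Cor. 2 (arXiv p. 4)] [cite: CoatesWiles1977, Thm 1 (p. 223)] -/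
theorem bsdTriple_of_hasCM_of_L_one_ne_zero_of_facts'
    (hA : bsdTriple_of_j_mem_maximalCMJInvariants_of_L_one_ne_zero)
    (hCW : finite_point_of_j_mem_maximalCMJInvariants_of_L_one_ne_zero)
    (hB : exists_isIsogenous_j_mem_maximalCMJInvariants_of_hasCM)
    (hKn : LFunction_eq_of_isIsogenous) (hISO : bsdRHS_eq_of_isIsogenous) :
    bsdTriple_of_hasCM_of_L_one_ne_zero :=
  bsdTriple_of_hasCM_of_L_one_ne_zero_of_BurungaleFlach2024
    (BurungaleFlach2024_bsd_rat_of_bsdTriple hCW hA) hB hKn hISO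

/-- **bsd.S28 (geometric-CM form), level 2.** Composition with the level-2 assembly of the
Burungale–Flach chain (`BurungaleFlach2024_bsd_rat_of_level2`,
`ComplexMultiplicationBurungaleFlachDescent.lean`): the fact follows from Corollary 1 over the CM
field (`h₁`), the Weil-restriction descent `K → ℚ` (`h₂`), Silverman's Ex. 2.12(b) (`hB`), Knapp
11.67 (`hKn`) and Cassels' quotient invariance (`hISO`) — i.e. from the hypotheses of
`bsdTriple_of_j_mem_maximalCMJInvariants_of_L_one_ne_zero_of_level2` and `hB`, `hKn`, `hISO`, the
last two being leaves of every deeper level of that chain.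
[cite: BurungaleFlach2024, Thm 1.1, Cor. 1, Cor. 2 (arXiv pp. 3–4)] -/
theorem bsdTriple_of_hasCM_of_L_one_ne_zero_of_level2
    (h₁ : BurungaleFlach2024_bsd_cmField) (h₂ : BurungaleFlach2024_bsd_rat_of_bsd_cmField)
    (hB : exists_isIsogenous_j_mem_maximalCMJInvariants_of_hasCM)
    (hKn : LFunction_eq_of_isIsogenous) (hISO : bsdRHS_eq_of_isIsogenous) :
    bsdTriple_of_hasCM_of_L_one_ne_zero :=
  bsdTriple_of_hasCM_of_L_one_ne_zero_of_BurungaleFlach2024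
    (BurungaleFlach2024_bsd_rat_of_level2 h₁ h₂) hB hKn hISO

/-- **bsd.S28 (geometric-CM form), level 3: no leaf beyond the verbatim form's but Silverman's
Ex. 2.12(b).** Composition with the level-3 assembly of the Burungale–Flach chain
(`BurungaleFlach2024_bsd_rat_of_bsd_cmField_of_level3`,
`ComplexMultiplicationBurungaleFlachDescentProofs.lean`): the fact follows from Corollary 1 over
the CM field (`h₁`), modularity (`hmod`), Artin formalism (`hBCL`), Milne's theorem on Weil
restriction in quotient form (`hBC`), Cassels' quotient invariance (`hISO`), Knapp 11.67 (`hKn`),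
`L(E,1) ≥ 0` (`hPOS`), the CM isogeny `E ∼ E^{(d_K)}` (`hTW`) — exactly the hypotheses of
`bsdTriple_of_j_mem_maximalCMJInvariants_of_L_one_ne_zero_of_level3` — and Silverman's
Ex. 2.12(b) (`hB`). [cite: BurungaleFlach2024, Thm 1.1, Cor. 1, Cor. 2 and its proof (arXiv pp. 3–4)] -/
theorem bsdTriple_of_hasCM_of_L_one_ne_zero_of_level3
    (h₁ : BurungaleFlach2024_bsd_cmField)
    (hmod : hasEntireLFunction_rat) (hBCL : LSeries_baseChange_quadratic)
    (hBC : bsdRHS_baseChange_quadratic) (hISO : bsdRHS_eq_of_isIsogenous)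
    (hKn : LFunction_eq_of_isIsogenous) (hPOS : re_entireLFunction_one_nonneg)
    (hTW : isIsogenous_quadraticTwist_cmFieldDiscr)
    (hB : exists_isIsogenous_j_mem_maximalCMJInvariants_of_hasCM) :
    bsdTriple_of_hasCM_of_L_one_ne_zero :=
  bsdTriple_of_hasCM_of_L_one_ne_zero_of_level2 h₁
    (BurungaleFlach2024_bsd_rat_of_bsd_cmField_of_level3 hmod hBCL hBC hISO hKn hPOS hTW) hB hKn hISO

/-- **Converse bookkeeping: the geometric-CM form gives back the verbatim form.** Under the
parent's fact `hasCM_of_j_mem_maximalCMJInvariants` (`hmax`: a curve over `ℚ` whose `j`-invariant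
is one of the nine maximal-order values has geometric CM; Silverman *AEC* C.11.3.1),
`bsdTriple_of_hasCM_of_L_one_ne_zero` (`h`) implies
`bsdTriple_of_j_mem_maximalCMJInvariants_of_L_one_ne_zero`; so the two forms of bsd.S28 are
equivalent modulo `hmax`, Silverman's Ex. 2.12(b), Knapp 11.67, Cassels and Coates–Wiles
(`bsdTriple_of_hasCM_of_L_one_ne_zero_of_facts'`).
[cite: BurungaleFlach2024, Cor. 2 (arXiv p. 4)] [cite: SilvermanAEC2009, App. C §11 (C.11.3.1)] -/
theorem bsdTriple_of_j_mem_maximalCMJInvariants_of_L_one_ne_zero_of_hasCM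
    (h : bsdTriple_of_hasCM_of_L_one_ne_zero) (hmax : hasCM_of_j_mem_maximalCMJInvariants) :
    bsdTriple_of_j_mem_maximalCMJInvariants_of_L_one_ne_zero :=
  fun W _ _ hj hL => h W (hmax W hj) hL

end Literature.NumberTheory.EllipticCurves

end
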